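import Mathlib
import Literature.Geometry.DiscreteGeometry.KissingNodeDegree
import Summits.AtomisticToContinuum.Crystallization.Theses.LaminarSixThreeThree

/-!
# `LaminarKissingCap` — the laminar kissing cap `6 + 3 + 3` (route LaminarSixThreeThree)

Item stmt-AtomisticToContinuum-14297 (support).  For a particle `j` of a finite configuration in
`ℝ³` with a unit normal `n`, levels `c : ℤ → ℝ` with consecutive gaps `≥ 19/25` and a level index
`l` such that every particle within distance `1` of `x j` lies within `1/250` of its level plane
(heights `⟪x k - x j, n⟫`), and pairwise distances `≥ 19/20` among those particles: at most `6`
same-level, at most `3` level-up and at most `3` level-down particles lie within distance `1`, and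
none is two or more levels away.

## Proof

Fix an orthonormal frame `b` of `ℝ³` with `b 2 = n` (`exists_orthonormalBasis_third_eq`) and write
`v = x k - x j = (X, Y, Z)`.
* Two levels away: `|Z| ≥ 2 · 19/25 − 2/250 = 1.512 > 1 ≥ ‖v‖`.
* Same level (`≤ 6`): `|Z| ≤ 2/250`, so the planar parts lie in the annulus
  `m ≤ X² + Y² ≤ 1`, `m = (19/20)² − (1/125)² = 0.902436`, with pairwise planar squared distances
  `≥ m`; in polar form two directions `θ, θ'` then satisfy `cos (θ − θ') ≤ κ = 1 − m/2 = 0.5488`,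
  and `arccos κ > 2π/7` (as `κ < 1 − (2π/7)²/2 ≤ cos (2π/7)`), so seven sorted directions would
  have seven cyclic gaps `≥ arccos κ` summing to `2π < 7 arccos κ`.
* Level up / down (`≤ 3`): `|Z| ≥ 19/25 − 2/250 = 0.752`, so `X² + Y² ≤ 1 − 0.752² = 0.4345`,
  while pairwise planar squared distances are `≥ m > 2 · 0.4345`: all pairwise planar inner
  products are negative, impossible for four vectors of the plane (in the frame of the first
  vector the other three have negative abscissae, and two of them ordinates of the same sign).
-/

namespace Summit.AtomisticToContinuum.Crystallization.Theorems

open Real RealInnerProductSpace Literature.Geometry.DiscreteGeometry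

noncomputable section

/-! ### Planar lemmas -/

/-- Among four vectors of the plane (given by coordinates), two distinct ones have a nonnegative
inner product: in the frame of the first vector, the other three would have negative abscissae
and pairwise opposite-sign ordinates, which three reals cannot have. -/
theorem LaminarKissingCap.exists_planar_inner_nonneg (X Y : Fin 4 → ℝ) :
    ∃ i k : Fin 4, i ≠ k ∧ 0 ≤ X i * X k + Y i * Y k := by
  by_contra h
  push Not at h
  have key : ∀ i k : Fin 4, (X 0 ^ 2 + Y 0 ^ 2) * (X i * X k + Y i * Y k) =
      (X 0 * X i + Y 0 * Y i) * (X 0 * X k + Y 0 * Y k)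
        + (X 0 * Y i - Y 0 * X i) * (X 0 * Y k - Y 0 * X k) := fun i k => by ring
  have hr : 0 ≤ X 0 ^ 2 + Y 0 ^ 2 := by positivity
  have a1 := h 0 1 (by decide)
  have a2 := h 0 2 (by decide)
  have a3 := h 0 3 (by decide)
  have n12 : (X 0 ^ 2 + Y 0 ^ 2) * (X 1 * X 2 + Y 1 * Y 2) ≤ 0 :=
    mul_nonpos_of_nonneg_of_nonpos hr (h 1 2 (by decide)).le
  have n13 : (X 0 ^ 2 + Y 0 ^ 2) * (X 1 * X 3 + Y 1 * Y 3) ≤ 0 :=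
    mul_nonpos_of_nonneg_of_nonpos hr (h 1 3 (by decide)).le
  have n23 : (X 0 ^ 2 + Y 0 ^ 2) * (X 2 * X 3 + Y 2 * Y 3) ≤ 0 :=
    mul_nonpos_of_nonneg_of_nonpos hr (h 2 3 (by decide)).le
  have p12 := mul_pos_of_neg_of_neg a1 a2
  have p13 := mul_pos_of_neg_of_neg a1 a3
  have p23 := mul_pos_of_neg_of_neg a2 a3
  rw [key] at n12 n13 n23
  set b1 := X 0 * Y 1 - Y 0 * X 1
  set b2 := X 0 * Y 2 - Y 0 * X 2
  set b3 := X 0 * Y 3 - Y 0 * X 3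
  have hb12 : b1 * b2 < 0 := by linarith
  have hb13 : b1 * b3 < 0 := by linarith
  have hb23 : b2 * b3 < 0 := by linarith
  have hprod := mul_pos_of_neg_of_neg hb12 hb13
  nlinarith [mul_nonpos_of_nonneg_of_nonpos (sq_nonneg b1) hb23.le]

/-- A nonnegative real whose cosine is `≤ κ` is at least `arccos κ`. -/
theorem LaminarKissingCap.arccos_le_of_cos_le {g κ : ℝ} (h0 : 0 ≤ g) (hc : cos g ≤ κ) :
    arccos κ ≤ g := by
  by_cases hg : g ≤ π
  · calc arccos κ ≤ arccos (cos g) := arccos_le_arccos hc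
      _ = g := arccos_cos h0 hg
  · exact (arccos_le_pi _).trans (le_of_lt (not_le.1 hg))

/-- **No seven sorted directions.** If `2π < 7 arccos κ`, seven angles
`−π < t₀ < t₁ < ⋯ < t₆ ≤ π` whose pairwise differences all have cosine `≤ κ` do not exist: the six
consecutive gaps and the wrap-around gap `2π − (t₆ − t₀)` are each `≥ arccos κ` and sum to `2π`. -/
theorem LaminarKissingCap.seven_sorted_angles_false {κ : ℝ} (hκ : 2 * π < 7 * arccos κ)
    (t : Fin 7 → ℝ) (hmono : StrictMono t) (hlo : -π < t 0) (hhi : t 6 ≤ π)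
    (hC : ∀ i j : Fin 7, i ≠ j → cos (t i - t j) ≤ κ) : False := by
  have gap : ∀ i j : Fin 7, i ≠ j → t j < t i → arccos κ ≤ t i - t j := fun i j hij hlt =>
    LaminarKissingCap.arccos_le_of_cos_le (sub_nonneg.2 hlt.le) (hC i j hij)
  have h10 := gap 1 0 (by decide) (hmono (by decide))
  have h21 := gap 2 1 (by decide) (hmono (by decide))
  have h32 := gap 3 2 (by decide) (hmono (by decide))
  have h43 := gap 4 3 (by decide) (hmono (by decide))
  have h54 := gap 5 4 (by decide) (hmono (by decide))
  have h65 := gap 6 5 (by decide) (hmono (by decide))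
  have hw : arccos κ ≤ 2 * π - (t 6 - t 0) := by
    refine LaminarKissingCap.arccos_le_of_cos_le (by linarith) ?_
    rw [cos_two_pi_sub]
    exact hC 6 0 (by decide)
  linarith

/-- `2π < 7 · arccos (1 − m/2)`: the minimal angular gap `arccos 0.548782 ≈ 56.7°` of two
same-level neighbours exceeds `2π/7 ≈ 51.4°` (via `cos (2π/7) ≥ 1 − (2π/7)²/2 > 1 − m/2`). -/
theorem LaminarKissingCap.two_pi_lt_seven_arccos :
    2 * π < 7 * arccos (1 - 225609 / 250000 / 2) := by
  have hpi := pi_lt_d2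
  have hpos : 0 < 2 * π / 7 := by positivity
  have hlt : 2 * π / 7 < 0.9 := by linarith
  have hκ : 1 - 225609 / 250000 / 2 < cos (2 * π / 7) := by
    have hc := one_sub_sq_div_two_le_cos (x := 2 * π / 7)
    nlinarith
  have h := arccos_lt_arccos (by norm_num) hκ (cos_le_one _)
  rw [arccos_cos hpos.le (by linarith)] at h
  linarith

/-- Elementary inequality behind the angular gap: for radii `ρ, ρ' ∈ [√m, 1]`,
`ρ² + ρ'² − (2 − m) ρ ρ' ≤ m` (with equality at `ρ = ρ' = 1`). -/
theorem LaminarKissingCap.sq_add_sq_sub_mul_le {ρ ρ' : ℝ} (h0 : 0 ≤ ρ) (h0' : 0 ≤ ρ')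
    (hlo : 225609 / 250000 ≤ ρ ^ 2) (hhi : ρ ^ 2 ≤ 1) (hlo' : 225609 / 250000 ≤ ρ' ^ 2)
    (hhi' : ρ' ^ 2 ≤ 1) :
    ρ ^ 2 + ρ' ^ 2 - (2 - 225609 / 250000) * ρ * ρ' ≤ 225609 / 250000 := by
  have h1 : ρ ≤ 1 := by nlinarith
  have h1' : ρ' ≤ 1 := by nlinarith
  have hl : 1 - 225609 / 250000 ≤ ρ := by nlinarith
  have hl' : 1 - 225609 / 250000 ≤ ρ' := by nlinarith
  rcases le_total ρ' ρ with hle | hle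
  · have e1 : 0 ≤ (1 - ρ') * (225609 / 250000 - 1 + ρ') := mul_nonneg (by linarith) (by linarith)
    have e2 : 0 ≤ (1 - ρ) * (1 + ρ - 2 * ρ') := mul_nonneg (by linarith) (by linarith)
    have e3 : 0 ≤ ρ' * (1 - ρ) := mul_nonneg h0' (by linarith)
    nlinarith
  · have e1 : 0 ≤ (1 - ρ) * (225609 / 250000 - 1 + ρ) := mul_nonneg (by linarith) (by linarith)
    have e2 : 0 ≤ (1 - ρ') * (1 + ρ' - 2 * ρ) := mul_nonneg (by linarith) (by linarith)
    have e3 : 0 ≤ ρ * (1 - ρ') := mul_nonneg h0 (by linarith)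
    nlinarith

/-- **No seven points in the annulus.** Seven points of the plane with `m ≤ X² + Y² ≤ 1` and
pairwise squared distances `≥ m` (`m = 0.902436`) do not exist: in polar coordinates any two
directions differ by at least `arccos (1 − m/2) > 2π/7`. -/
theorem LaminarKissingCap.no_seven_annulus (X Y : Fin 7 → ℝ)
    (hlo : ∀ i, 225609 / 250000 ≤ X i ^ 2 + Y i ^ 2) (hhi : ∀ i, X i ^ 2 + Y i ^ 2 ≤ 1)
    (hsep : ∀ i k, i ≠ k → 225609 / 250000 ≤ (X i - X k) ^ 2 + (Y i - Y k) ^ 2) : False := by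
  set ρ : Fin 7 → ℝ := fun i => ‖(⟨X i, Y i⟩ : ℂ)‖ with hρdef
  set θ : Fin 7 → ℝ := fun i => Complex.arg ⟨X i, Y i⟩ with hθdef
  have hρsq : ∀ i, ρ i ^ 2 = X i ^ 2 + Y i ^ 2 := by
    intro i
    simp only [hρdef, Complex.sq_norm, Complex.normSq_mk]
    ring
  have hρ0 : ∀ i, 0 ≤ ρ i := fun i => norm_nonneg _
  have hρpos : ∀ i, 0 < ρ i := by
    intro i
    rcases (hρ0 i).lt_or_eq with h | h
    · exact h
    · have := hlo i; rw [← hρsq, ← h] at this; norm_num at this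
  have hX : ∀ i, X i = ρ i * cos (θ i) := fun i => (Complex.norm_mul_cos_arg ⟨X i, Y i⟩).symm
  have hY : ∀ i, Y i = ρ i * sin (θ i) := fun i => (Complex.norm_mul_sin_arg ⟨X i, Y i⟩).symm
  have hcos : ∀ i k, i ≠ k → cos (θ i - θ k) ≤ 1 - 225609 / 250000 / 2 := by
    intro i k hik
    have hdot : X i * X k + Y i * Y k = ρ i * ρ k * cos (θ i - θ k) := by
      rw [hX i, hX k, hY i, hY k, cos_sub]; ring
    have hexp : (X i - X k) ^ 2 + (Y i - Y k) ^ 2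
        = ρ i ^ 2 + ρ k ^ 2 - 2 * (ρ i * ρ k * cos (θ i - θ k)) := by
      rw [← hdot, hρsq, hρsq]; ring
    have hs := hsep i k hik
    rw [hexp] at hs
    have halg := LaminarKissingCap.sq_add_sq_sub_mul_le (hρ0 i) (hρ0 k)
      ((hρsq i).symm ▸ hlo i) ((hρsq i).symm ▸ hhi i) ((hρsq k).symm ▸ hlo k)
      ((hρsq k).symm ▸ hhi k)
    have hpos : 0 < ρ i * ρ k := mul_pos (hρpos i) (hρpos k)
    by_contra hc
    push Not at hc
    have := mul_lt_mul_of_pos_left hc hpos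
    nlinarith
  have hθinj : Function.Injective θ := by
    intro i k hik
    by_contra hne
    have := hcos i k hne
    rw [hik, sub_self, cos_zero] at this
    norm_num at this
  have hAcard : (Finset.univ.image θ).card = 7 := by
    rw [Finset.card_image_of_injective _ hθinj, Finset.card_univ, Fintype.card_fin]
  let e := (Finset.univ.image θ).orderEmbOfFin hAcard
  have hmem : ∀ k, ∃ i, θ i = e k := by
    intro k
    have := (Finset.univ.image θ).orderEmbOfFin_mem hAcard k
    rw [Finset.mem_image] at this
    obtain ⟨i, -, hi⟩ := this
    exact ⟨i, hi⟩
  choose π' hπ' using hmem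
  refine LaminarKissingCap.seven_sorted_angles_false LaminarKissingCap.two_pi_lt_seven_arccos
    (fun k => e k) e.strictMono ?_ ?_ ?_
  · show -π < e 0
    rw [← hπ' 0]
    exact Complex.neg_pi_lt_arg _
  · show e 6 ≤ π
    rw [← hπ' 6]
    exact Complex.arg_le_pi _
  · intro i j hij
    have hne : π' i ≠ π' j := by
      intro h
      apply hij
      apply e.injective
      rw [← hπ' i, ← hπ' j, h]
    rw [← hπ' i, ← hπ' j]
    exact hcos _ _ hne

/-! ### Space lemmas: a frame adapted to the normal -/

/-- Coordinates in an orthonormal frame of `ℝ³` whose third vector is the unit normal `n`: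
`‖v‖² = X² + Y² + ⟪v, n⟫²` and the same for differences. -/
theorem LaminarKissingCap.exists_frame {n : EuclideanSpace ℝ (Fin 3)} (hn : ‖n‖ = 1) :
    ∃ b : OrthonormalBasis (Fin 3) ℝ (EuclideanSpace ℝ (Fin 3)),
      (∀ v, ‖v‖ ^ 2 = ⟪b 0, v⟫ ^ 2 + ⟪b 1, v⟫ ^ 2 + ⟪v, n⟫ ^ 2) ∧
      ∀ v w, ‖v - w‖ ^ 2
        = (⟪b 0, v⟫ - ⟪b 0, w⟫) ^ 2 + (⟪b 1, v⟫ - ⟪b 1, w⟫) ^ 2 + (⟪v, n⟫ - ⟪w, n⟫) ^ 2 := by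
  obtain ⟨b, hb⟩ := exists_orthonormalBasis_third_eq (v := (2 : ℝ) • n)
    (by rw [norm_smul, hn]; norm_num)
  rw [smul_smul, show (1 / 2 * 2 : ℝ) = 1 by norm_num, one_smul] at hb
  refine ⟨b, fun v => ?_, fun v w => ?_⟩
  · rw [← real_inner_self_eq_norm_sq, inner_eq_sum_three b, hb, real_inner_comm n]; ring
  · rw [← real_inner_self_eq_norm_sq, inner_eq_sum_three b, hb]
    simp only [inner_sub_right, real_inner_comm n]
    ring

/-- **No four neighbours in an adjacent level.** Four vectors of norm `≤ 1`, pairwise `≥ 19/20`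
apart, whose heights along a unit normal are `≥ 0.752` in absolute value and within `1/125` of
each other, do not exist (their planar parts would be four vectors in a disc of radius
`√(1 − 0.752²) = 0.659` with pairwise negative inner products). -/
theorem LaminarKissingCap.no_four_adjacent {n : EuclideanSpace ℝ (Fin 3)} (hn : ‖n‖ = 1)
    (v : Fin 4 → EuclideanSpace ℝ (Fin 3)) (hv1 : ∀ i, ‖v i‖ ≤ 1)
    (hsep : ∀ i k, i ≠ k → 19 / 20 ≤ ‖v i - v k‖) (hZ : ∀ i, 94 / 125 ≤ |⟪v i, n⟫|)
    (hZZ : ∀ i k, |⟪v i, n⟫ - ⟪v k, n⟫| ≤ 1 / 125) : False := by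
  obtain ⟨b, hnorm, hd⟩ := LaminarKissingCap.exists_frame hn
  obtain ⟨i, k, hik, hdot⟩ :=
    LaminarKissingCap.exists_planar_inner_nonneg (fun i => ⟪b 0, v i⟫) (fun i => ⟪b 1, v i⟫)
  have h1 : ‖v i‖ ^ 2 ≤ 1 := pow_le_one₀ (norm_nonneg _) (hv1 i)
  have h2 : ‖v k‖ ^ 2 ≤ 1 := pow_le_one₀ (norm_nonneg _) (hv1 k)
  have h3 : (19 / 20 : ℝ) ^ 2 ≤ ‖v i - v k‖ ^ 2 := pow_le_pow_left₀ (by norm_num) (hsep i k hik) 2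
  have h4 : (94 / 125 : ℝ) ^ 2 ≤ ⟪v i, n⟫ ^ 2 := by
    rw [← sq_abs (⟪v i, n⟫)]; exact pow_le_pow_left₀ (by norm_num) (hZ i) 2
  have h5 : (94 / 125 : ℝ) ^ 2 ≤ ⟪v k, n⟫ ^ 2 := by
    rw [← sq_abs (⟪v k, n⟫)]; exact pow_le_pow_left₀ (by norm_num) (hZ k) 2
  have h6 : (⟪v i, n⟫ - ⟪v k, n⟫) ^ 2 ≤ (1 / 125 : ℝ) ^ 2 := by
    rw [← sq_abs (⟪v i, n⟫ - _)]; exact pow_le_pow_left₀ (abs_nonneg _) (hZZ i k) 2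
  nlinarith [hnorm (v i), hnorm (v k), hd (v i) (v k)]

/-- **No seven neighbours in the same level.** Seven vectors with norms in `[19/20, 1]`, pairwise
`≥ 19/20` apart, whose heights along a unit normal are `≤ 1/125` in absolute value and within
`1/125` of each other, do not exist (their planar parts would be seven points of the annulus of
`no_seven_annulus`). -/
theorem LaminarKissingCap.no_seven_level {n : EuclideanSpace ℝ (Fin 3)} (hn : ‖n‖ = 1)
    (v : Fin 7 → EuclideanSpace ℝ (Fin 3)) (hv0 : ∀ i, 19 / 20 ≤ ‖v i‖) (hv1 : ∀ i, ‖v i‖ ≤ 1)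
    (hsep : ∀ i k, i ≠ k → 19 / 20 ≤ ‖v i - v k‖) (hZ : ∀ i, |⟪v i, n⟫| ≤ 1 / 125)
    (hZZ : ∀ i k, |⟪v i, n⟫ - ⟪v k, n⟫| ≤ 1 / 125) : False := by
  obtain ⟨b, hnorm, hd⟩ := LaminarKissingCap.exists_frame hn
  refine LaminarKissingCap.no_seven_annulus (fun i => ⟪b 0, v i⟫) (fun i => ⟪b 1, v i⟫)
    ?_ ?_ ?_
  · intro i
    have h0 : (19 / 20 : ℝ) ^ 2 ≤ ‖v i‖ ^ 2 := pow_le_pow_left₀ (by norm_num) (hv0 i) 2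
    have hz : ⟪v i, n⟫ ^ 2 ≤ (1 / 125 : ℝ) ^ 2 := by
      rw [← sq_abs (⟪v i, n⟫)]; exact pow_le_pow_left₀ (abs_nonneg _) (hZ i) 2
    have := hnorm (v i)
    show (225609 / 250000 : ℝ) ≤ _
    nlinarith
  · intro i
    have h1 : ‖v i‖ ^ 2 ≤ 1 := pow_le_one₀ (norm_nonneg _) (hv1 i)
    have := hnorm (v i)
    nlinarith [sq_nonneg (⟪v i, n⟫)]
  · intro i k hik
    have h3 : (19 / 20 : ℝ) ^ 2 ≤ ‖v i - v k‖ ^ 2 :=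
      pow_le_pow_left₀ (by norm_num) (hsep i k hik) 2
    have h6 : (⟪v i, n⟫ - ⟪v k, n⟫) ^ 2 ≤ (1 / 125 : ℝ) ^ 2 := by
      rw [← sq_abs (⟪v i, n⟫ - _)]; exact pow_le_pow_left₀ (abs_nonneg _) (hZZ i k) 2
    have := hd (v i) (v k)
    show (225609 / 250000 : ℝ) ≤ _
    nlinarith

/-! ### Counting wrappers -/

/-- If more than `m` indices satisfy `P`, there are `m + 1` distinct indices satisfying `P`. -/
theorem LaminarKissingCap.exists_embedding_of_lt_card {N m : ℕ} {P : Fin N → Prop}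
    (h : m < Nat.card {k : Fin N // P k}) : ∃ f : Fin (m + 1) ↪ Fin N, ∀ i, P (f i) := by
  classical
  rw [Nat.card_eq_fintype_card] at h
  obtain ⟨g⟩ := Function.Embedding.nonempty_of_card_le (α := Fin (m + 1))
    (β := {k : Fin N // P k}) (by rw [Fintype.card_fin]; omega)
  exact ⟨g.trans (Function.Embedding.subtype _), fun i => (g i).2⟩

/-- **Adjacent-level cap.** At most three particles within distance `1` of `x j` have heights
within `1/250` of a common value `z₀` with `|z₀| ≥ 189/250`, given the separation `≥ 19/20`. -/
theorem LaminarKissingCap.card_adjacent_le_three {N : ℕ} {x : Fin N → EuclideanSpace ℝ (Fin 3)}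
    {j : Fin N} {n : EuclideanSpace ℝ (Fin 3)} (hn : ‖n‖ = 1) {P : Fin N → Prop} {z₀ : ℝ}
    (hz₀ : 189 / 250 ≤ |z₀|)
    (hP : ∀ k, P k → dist (x j) (x k) ≤ 1 ∧ |⟪x k - x j, n⟫ - z₀| ≤ 1 / 250)
    (hsep : ∀ k k' : Fin N, dist (x j) (x k) ≤ 1 → dist (x j) (x k') ≤ 1 → k ≠ k' →
      19 / 20 ≤ dist (x k) (x k')) :
    Nat.card {k : Fin N // P k} ≤ 3 := by
  by_contra hgt
  push Not at hgt
  obtain ⟨f, hf⟩ := LaminarKissingCap.exists_embedding_of_lt_card hgt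
  refine LaminarKissingCap.no_four_adjacent hn (fun i => x (f i) - x j) ?_ ?_ ?_ ?_
  · intro i
    rw [← dist_eq_norm, dist_comm]
    exact (hP _ (hf i)).1
  · intro i k hik
    rw [sub_sub_sub_cancel_right, ← dist_eq_norm]
    exact hsep _ _ (hP _ (hf i)).1 (hP _ (hf k)).1 (f.injective.ne hik)
  · intro i
    have h1 := abs_sub_abs_le_abs_sub z₀ ⟪x (f i) - x j, n⟫
    rw [abs_sub_comm] at h1
    linarith [(hP _ (hf i)).2]
  · intro i k
    have h1 := abs_le.1 (hP _ (hf i)).2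
    have h3 := abs_le.1 (hP _ (hf k)).2
    rw [abs_le]; constructor <;> linarith [h1.1, h1.2, h3.1, h3.2]

/-- **Same-level cap.** At most six particles other than `j` within distance `1` of `x j` have
heights within `1/250` of a common value `z₀` with `|z₀| ≤ 1/250`, given the separation `≥ 19/20`
(which also puts them at distance `≥ 19/20` from `x j`). -/
theorem LaminarKissingCap.card_level_le_six {N : ℕ} {x : Fin N → EuclideanSpace ℝ (Fin 3)}
    {j : Fin N} {n : EuclideanSpace ℝ (Fin 3)} (hn : ‖n‖ = 1) {P : Fin N → Prop} {z₀ : ℝ}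
    (hz₀ : |z₀| ≤ 1 / 250)
    (hP : ∀ k, P k → k ≠ j ∧ dist (x j) (x k) ≤ 1 ∧ |⟪x k - x j, n⟫ - z₀| ≤ 1 / 250)
    (hsep : ∀ k k' : Fin N, dist (x j) (x k) ≤ 1 → dist (x j) (x k') ≤ 1 → k ≠ k' →
      19 / 20 ≤ dist (x k) (x k')) :
    Nat.card {k : Fin N // P k} ≤ 6 := by
  by_contra hgt
  push Not at hgt
  obtain ⟨f, hf⟩ := LaminarKissingCap.exists_embedding_of_lt_card hgt
  have hjj : dist (x j) (x j) ≤ 1 := by simp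
  have hz := abs_le.1 hz₀
  refine LaminarKissingCap.no_seven_level hn (fun i => x (f i) - x j) ?_ ?_ ?_ ?_ ?_
  · intro i
    rw [← dist_eq_norm]
    exact hsep _ _ (hP _ (hf i)).2.1 hjj (hP _ (hf i)).1
  · intro i
    rw [← dist_eq_norm, dist_comm]
    exact (hP _ (hf i)).2.1
  · intro i k hik
    rw [sub_sub_sub_cancel_right, ← dist_eq_norm]
    exact hsep _ _ (hP _ (hf i)).2.1 (hP _ (hf k)).2.1 (f.injective.ne hik)
  · intro i
    have h1 := abs_le.1 (hP _ (hf i)).2.2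
    rw [abs_le]; constructor <;> linarith [h1.1, h1.2, hz.1, hz.2]
  · intro i k
    have h1 := abs_le.1 (hP _ (hf i)).2.2
    have h3 := abs_le.1 (hP _ (hf k)).2.2
    rw [abs_le]; constructor <;> linarith [h1.1, h1.2, h3.1, h3.2]

/-! ### The item -/

/-- **Item stmt-AtomisticToContinuum-14297** (`LaminarKissingCap`, support of route
LaminarSixThreeThree): the laminar kissing cap.  For a particle `j` with unit normal `n`, levels
`c` with gaps `≥ 19/25` and level index `l` such that every particle within distance `1` of `x j`
is within `1/250` of its level, and pairwise distances `≥ 19/20` among `j` and those particles: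
at most `6` same-level, at most `3` level-up, at most `3` level-down particles within distance
`1`, and none two or more levels away. -/
theorem laminarKissingCap_proof :
    Summit.AtomisticToContinuum.Crystallization.Theses.LaminarSixThreeThree.LaminarKissingCap := by
  intro N x j n c l hn hc hlev hsep
  have hcj : |c (l j)| ≤ 1 / 250 := by
    have := hlev j (by simp)
    rwa [sub_self, inner_zero_left, zero_sub, abs_neg] at this
  have hcj' := abs_le.1 hcj
  have hcmono : Monotone c := monotone_int_of_le_succ fun k => by linarith [hc k]
  have hup : c (l j) + 19 / 25 ≤ c (l j + 1) := hc (l j)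
  have hdown : c (l j - 1) + 19 / 25 ≤ c (l j) := by
    have := hc (l j - 1); rwa [sub_add_cancel] at this
  refine ⟨?_, ?_, ?_, fun k hk => ?_⟩
  · exact LaminarKissingCap.card_level_le_six hn hcj
      (fun k hk => ⟨hk.1, hk.2.2, hk.2.1 ▸ hlev k hk.2.2⟩) hsep
  · refine LaminarKissingCap.card_adjacent_le_three hn (z₀ := c (l j + 1)) ?_
      (fun k hk => ⟨hk.2, hk.1 ▸ hlev k hk.2⟩) hsep
    rw [le_abs]; left; linarith
  · refine LaminarKissingCap.card_adjacent_le_three hn (z₀ := c (l j - 1)) ?_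
      (fun k hk => ⟨hk.2, hk.1 ▸ hlev k hk.2⟩) hsep
    rw [le_abs]; right; linarith
  · -- no particle two or more levels away
    have hl := abs_le.1 (hlev k hk)
    have hz : |⟪x k - x j, n⟫| ≤ 1 := by
      calc |⟪x k - x j, n⟫| ≤ ‖x k - x j‖ * ‖n‖ := abs_real_inner_le_norm _ _
        _ ≤ 1 := by rw [hn, mul_one, ← dist_eq_norm, dist_comm]; exact hk
    have hz' := abs_le.1 hz
    constructor
    · by_contra hlt
      push Not at hlt
      have hm : c (l k) ≤ c (l j - 2) := hcmono (by omega)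
      have h1 := hc (l j - 2)
      rw [show l j - 2 + 1 = l j - 1 by ring] at h1
      linarith [hl.1, hl.2, hz'.1, hz'.2]
    · by_contra hlt
      push Not at hlt
      have hm : c (l j + 2) ≤ c (l k) := hcmono (by omega)
      have h2 := hc (l j + 1)
      rw [show l j + 1 + 1 = l j + 2 by ring] at h2
      linarith [hl.1, hl.2, hz'.1, hz'.2]

end

end Summit.AtomisticToContinuum.Crystallization.Theorems
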